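import Summits.QuantumFields.GaugeBoot.DiagonalRPTorusThreeByThreeStaircase
import Summits.QuantumFields.GaugeBoot.DiagonalRPTorusThreeByThreeReaders
import HarnessLib

/-!
# The first plaquette moments of the staircase pairing on `(ℤ/3)²`: orders `0, 1, 2` vanish, order `3`
is positive (gauge-boot, L3 — the last `d = 2` cell `L = 3`, `β < 0`, 2b/3)

HONEST FRAMING (cell `pub-gaugeboot`, page 1 of every file): the venture produces certified bounds
on lattice expectations at stated coupling, gauge group, dimension and torus size; NOT a mass gap,
NOT a continuum limit, NOT a string tension; NOT Yang–Mills-summit-bearing (barriers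
`FixedCouplingUltralocality`, `PerturbativeInvisibility`). The combinatorial core of the NEGATIVE
structural result `DiagonalRPTorusThreeByThreeNegative.lean`; no number is certified.

## Content (torus `(ℤ/3)²`, `i ≠ j`, `ρ` continuous with scalar commutant and `ρ ≢ 1`)

With `Φ₀(U) = tr ρ(stairC 3 U) conj tr ρ(stairD 3 U)` (the staircase pairing), `r_y = Re tr ρ(U_y)`
the plaquette term at the base site `y`, `R = Σ_y r_y` (all nine plaquettes) and `π` product Haar:

* `integral_term_eq_zero_j/_i` — a tuple of plaquettes `p : Fin k → sites` missing both readers of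
  some mirror link `(dg t, j)` (resp. `(dg t, i)`; readers: `DiagonalRPTorusThreeByThreeReaders`) has
  `∫ Φ₀ ∏_m r_{p m} dπ = 0` (lonely mirror link of `DiagonalRPTorusThreeByThreeStaircase`; the
  `i`-links by its swap symmetry); with the pigeonhole of `…Readers`: every tuple of fewer than three
  plaquettes, and every triple that is not a permutation of the mirror plaquettes, has term `0`
  (`integral_term_eq_zero_of_lt`, `integral_term_eq_zero_of_not_perm`).
* ★ `integral_term_dg_eq` — the surviving term: `∫ Φ₀ r_{dg 0} r_{dg 1} r_{dg 2} dπ = κ³ P₀`,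
  `P₀ = ∫ |tr ρ(stairC 3 U)|² dπ > 0`, `κ = (∫ (Re χ_ρ)²)/N > 0` (three one-link stages of the tree's
  `integral_stage` with the weight `Re χ_ρ`).
* ★★ **`integral_pair_mul_pow_eq_zero`** (`k < 3`: `∫ Φ₀ R^k dπ = 0`) and
  ★★ **`integral_pair_mul_cube`** (`∫ Φ₀ R³ dπ = c` with `c` real, `c ≥ κ³ P₀ > 0`).

So the Taylor jet of `β ↦ ∫ Φ₀ e^{βR} dπ` at `β = 0` starts with a POSITIVE cubic term — the sign
change of the gauge-invariant diagonal RP form at `β = 0` on the `3 × 3` torus (module 3).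
Elementary. [folklore]
-/

open MeasureTheory Complex Finset Function
open scoped ComplexOrder

namespace Summit.QuantumFields.GaugeBoot

open Literature.MathematicalPhysics.QuantumFieldTheory
open Literature.RepresentationTheory.CompactGroups

noncomputable section

namespace DiagRPTwo

/-! ## The plaquette terms of the staircase pairing -/

section Terms

variable {N : ℕ} {G : Type*} [Group G] [TopologicalSpace G] [IsTopologicalGroup G]
  [CompactSpace G] [MeasurableSpace G] [BorelSpace G] [SecondCountableTopology G]
  (ρ : G →* Matrix (Fin N) (Fin N) ℂ) {i j : Fin 2}

/-- ★ LONELY `j`-LINK: a tuple missing both readers of `(dg t, j)` has vanishing term. -/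
theorem integral_term_eq_zero_j (hij : i ≠ j) (hρ : Continuous ρ)
    (hirr : TwistedSlab.HasScalarCommutant ρ) (hρ1 : ∃ g, ρ g ≠ 1) {k : ℕ} {p : Fin k → Site 2 3}
    {t : ℕ} (ht : t < 3) (hp : ∀ m, p m ≠ dg t ∧ (p m).shift i ≠ dg t) :
    ∫ U, (ρ (stairC i j 3 U)).trace * (starRingEnd ℂ) ((ρ (stairD i j 3 U)).trace) *
      ∏ m, (rr ρ i j U (p m) : ℂ) ∂(linkMeasure 3 G) = 0 := by
  refine integral_stairPair_mul_eq_zero ρ (by norm_num) hij hρ hirr hρ1 ht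
    (continuous_finsetProd _ fun m _ => Complex.continuous_ofReal.comp (continuous_rr' ρ hρ _))
    fun U s => Finset.prod_congr rfl fun m _ => ?_
  have hne : ((dg t, j) : Edge 2 3) ∉ blk i j (p m) := fun h => by
    rcases mem_readers_j hij h with h | h
    · exact (hp m).1 h
    · exact (hp m).2 h
  rw [rr_update_of_not_mem_blk ρ U hne]

/-- ★ LONELY `i`-LINK: a tuple missing both readers of `(dg t, i)` has vanishing term (swap
symmetry: the swapped tuple misses both readers of `(dg t, j)`). -/
theorem integral_term_eq_zero_i (hij : i ≠ j) (hρ : Continuous ρ)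
    (hirr : TwistedSlab.HasScalarCommutant ρ) (hρ1 : ∃ g, ρ g ≠ 1) {k : ℕ} {p : Fin k → Site 2 3}
    {t : ℕ} (ht : t < 3) (hp : ∀ m, p m ≠ dg t ∧ (p m).shift j ≠ dg t) :
    ∫ U, (ρ (stairC i j 3 U)).trace * (starRingEnd ℂ) ((ρ (stairD i j 3 U)).trace) *
      ∏ m, (rr ρ i j U (p m) : ℂ) ∂(linkMeasure 3 G) = 0 := by
  -- the swapped tuple misses both readers of `(dg t, j)`
  have hp' : ∀ m, siteDiagSwap i j (p m) ≠ dg t ∧ (siteDiagSwap i j (p m)).shift i ≠ dg t := by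
    intro m
    refine ⟨fun h => (hp m).1 ?_, fun h => (hp m).2 ?_⟩
    · rw [← siteDiagSwap_dg i j t] at h
      exact siteDiagSwap_injective' h
    · rw [← siteDiagSwap_shift_j, ← siteDiagSwap_dg i j t] at h
      exact siteDiagSwap_injective' h
  have h0 := integral_term_eq_zero_j ρ hij hρ hirr hρ1 ht hp'
  -- the term of `p` is the conjugate of the term of the swapped tuple
  have h1 : ∀ U : GaugeConfig 2 3 G, (∏ m, (rr ρ i j U (p m) : ℂ)) =
      ((∏ m, rr ρ i j (configDiagSwap i j U) (siteDiagSwap i j (p m)) : ℝ) : ℂ) := by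
    intro U
    rw [Complex.ofReal_prod]
    refine Finset.prod_congr rfl fun m _ => ?_
    rw [rr_configDiagSwap ρ hρ, siteDiagSwap_siteDiagSwap]
  simp_rw [h1]
  rw [integral_stairPair_mul_comp_swap ρ (fun V => ∏ m, rr ρ i j V (siteDiagSwap i j (p m)))]
  simp_rw [Complex.ofReal_prod]
  rw [h0, map_zero]

/-- ★ DICHOTOMY for triples: a triple of plaquettes that is not a permutation of the mirror has
vanishing term. -/
theorem integral_term_eq_zero_of_not_perm (hij : i ≠ j) (hρ : Continuous ρ)
    (hirr : TwistedSlab.HasScalarCommutant ρ) (hρ1 : ∃ g, ρ g ≠ 1) {p : Fin 3 → Site 2 3}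
    (hp : ¬ ∃ σ : Equiv.Perm (Fin 3), ∀ t, p (σ t) = dg (t : ℕ)) :
    ∫ U, (ρ (stairC i j 3 U)).trace * (starRingEnd ℂ) ((ρ (stairD i j 3 U)).trace) *
      ∏ m, (rr ρ i j U (p m) : ℂ) ∂(linkMeasure 3 G) = 0 := by
  by_cases hP : ∀ t : Fin 3, ∃ m, p m = dg (t : ℕ) ∨ (p m).shift i = dg (t : ℕ)
  · by_cases hQ : ∀ t : Fin 3, ∃ m, p m = dg (t : ℕ) ∨ (p m).shift j = dg (t : ℕ)
    · exact absurd (exists_perm_of_readers hij hP hQ) hp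
    · push Not at hQ
      obtain ⟨t, ht⟩ := hQ
      exact integral_term_eq_zero_i ρ hij hρ hirr hρ1 t.isLt ht
  · push Not at hP
    obtain ⟨t, ht⟩ := hP
    exact integral_term_eq_zero_j ρ hij hρ hirr hρ1 t.isLt ht

/-- ★ SHORT TUPLES VANISH: fewer than three plaquettes never meet the three `j`-reader pairs. -/
theorem integral_term_eq_zero_of_lt (hij : i ≠ j) (hρ : Continuous ρ)
    (hirr : TwistedSlab.HasScalarCommutant ρ) (hρ1 : ∃ g, ρ g ≠ 1) {k : ℕ} (hk : k < 3)
    (p : Fin k → Site 2 3) :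
    ∫ U, (ρ (stairC i j 3 U)).trace * (starRingEnd ℂ) ((ρ (stairD i j 3 U)).trace) *
      ∏ m, (rr ρ i j U (p m) : ℂ) ∂(linkMeasure 3 G) = 0 := by
  by_cases hP : ∀ t : Fin 3, ∃ m, p m = dg (t : ℕ) ∨ (p m).shift i = dg (t : ℕ)
  · exact absurd (three_le_of_readers hij hP) (by omega)
  · push Not at hP
    obtain ⟨t, ht⟩ := hP
    exact integral_term_eq_zero_j ρ hij hρ hirr hρ1 t.isLt ht

/-! ### The surviving term: three one-link stages with the weight `Re χ` -/

/-- ★ **The mirror triple**: `∫ Φ₀ r_{dg 0} r_{dg 1} r_{dg 2} dπ = κ³ · ∫ |tr ρ(stairC 3 U)|² dπ`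
when `wAvg ρ (Re χ_ρ) = κ • 1`. -/
theorem integral_term_dg_eq (hij : i ≠ j) (hρ : Continuous ρ) {κ : ℝ}
    (hκ : TwistedSlab.wAvg ρ (fun g => ((ρ g).trace).re) = ((κ : ℂ)) • (1 : Matrix (Fin N) (Fin N) ℂ)) :
    ∫ U, (ρ (stairC i j 3 U)).trace * (starRingEnd ℂ) ((ρ (stairD i j 3 U)).trace) *
        ∏ t : Fin 3, (rr ρ i j U (dg (t : ℕ)) : ℂ) ∂(linkMeasure 3 G) =
      (((κ ^ 3 * ∫ U, Complex.normSq ((ρ (stairC i j 3 U)).trace) ∂(linkMeasure 3 G)) : ℝ) : ℂ) := by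
  set w : G → ℝ := fun g => ((ρ g).trace).re with hw
  have hwc : Continuous w := continuous_reChar ρ hρ
  have h2 : 2 ≤ 3 := by norm_num
  have hrr : ∀ (U : GaugeConfig 2 3 G) (t : ℕ),
      rr ρ i j U (dg t) = w (cT i j U (dg t) * (dT i j U (dg t))⁻¹) := fun U t => rfl
  have hwc' : ∀ t : ℕ, Continuous fun U : GaugeConfig 2 3 G => (w (cT i j U (dg t) * (dT i j U (dg t))⁻¹) : ℂ) :=
    fun t => Complex.continuous_ofReal.comp (hwc.comp ((continuous_cT _).mul (continuous_dT _).inv))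
  have hupd : ∀ {k t : ℕ}, k < 3 → t < 3 → t ≠ k → ∀ (U : GaugeConfig 2 3 G) (s : G),
      w (cT i j (Function.update U (dg k, j) s) (dg t) * (dT i j (Function.update U (dg k, j) s) (dg t))⁻¹) =
        w (cT i j U (dg t) * (dT i j U (dg t))⁻¹) := by
    intro k t hk ht htk U s
    rw [cT_update_dgj h2 hij, dT_update_dgj_of_ne hij U hk ht htk]
  -- rewrite the integrand in the stage-0 form
  have h0 : ∀ U : GaugeConfig 2 3 G,
      (ρ (stairC i j 3 U)).trace * (starRingEnd ℂ) ((ρ (stairD i j 3 U)).trace) *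
          ∏ t : Fin 3, (rr ρ i j U (dg (t : ℕ)) : ℂ) =
        (ρ (stairC i j 3 U)).trace * (starRingEnd ℂ) ((ρ (stairM i j 0 3 U)).trace) *
          (w (cT i j U (dg 0) * (dT i j U (dg 0))⁻¹) : ℂ) *
          ((w (cT i j U (dg 1) * (dT i j U (dg 1))⁻¹) : ℂ) * (w (cT i j U (dg 2) * (dT i j U (dg 2))⁻¹) : ℂ)) := by
    intro U
    rw [Fin.prod_univ_three, stairM_zero_left]
    simp only [Fin.val_zero, Fin.val_one, Fin.val_two, hrr]
    ring
  simp_rw [h0]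
  -- stage 0
  rw [integral_stage ρ h2 hij hρ hwc hκ (k := 0) (by norm_num)
    (R := fun U => (w (cT i j U (dg 1) * (dT i j U (dg 1))⁻¹) : ℂ) *
      (w (cT i j U (dg 2) * (dT i j U (dg 2))⁻¹) : ℂ))
    ((hwc' 1).mul (hwc' 2)) (fun U s => by
      rw [hupd (by norm_num) (by norm_num) (by norm_num), hupd (by norm_num) (by norm_num) (by norm_num)])]
  -- stage 1
  have h1 : ∀ U : GaugeConfig 2 3 G,
      (ρ (stairC i j 3 U)).trace * (starRingEnd ℂ) ((ρ (stairM i j (0 + 1) 3 U)).trace) *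
          ((w (cT i j U (dg 1) * (dT i j U (dg 1))⁻¹) : ℂ) * (w (cT i j U (dg 2) * (dT i j U (dg 2))⁻¹) : ℂ)) =
        (ρ (stairC i j 3 U)).trace * (starRingEnd ℂ) ((ρ (stairM i j 1 3 U)).trace) *
          (w (cT i j U (dg 1) * (dT i j U (dg 1))⁻¹) : ℂ) * (w (cT i j U (dg 2) * (dT i j U (dg 2))⁻¹) : ℂ) := by
    intro U; rw [zero_add]; ring
  simp_rw [h1]
  rw [integral_stage ρ h2 hij hρ hwc hκ (k := 1) (by norm_num)
    (R := fun U => (w (cT i j U (dg 2) * (dT i j U (dg 2))⁻¹) : ℂ)) (hwc' 2)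
    (fun U s => by rw [hupd (by norm_num) (by norm_num) (by norm_num)])]
  -- stage 2
  have hst2 : ∫ U, (ρ (stairC i j 3 U)).trace * (starRingEnd ℂ) ((ρ (stairM i j (1 + 1) 3 U)).trace) *
        (w (cT i j U (dg 2) * (dT i j U (dg 2))⁻¹) : ℂ) ∂(linkMeasure 3 G) =
      (κ : ℂ) * ∫ U, (ρ (stairC i j 3 U)).trace * (starRingEnd ℂ) ((ρ (stairM i j 3 3 U)).trace)
        ∂(linkMeasure 3 G) := by
    have := integral_stage ρ h2 hij hρ hwc hκ (k := 2) (by norm_num) (R := fun _ => (1 : ℂ))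
      continuous_const (fun U s => rfl)
    simpa only [mul_one] using this
  rw [hst2]
  -- the final integrand `|tr ρ(stairC 3 U)|²`
  have h3 : ∀ U : GaugeConfig 2 3 G,
      (ρ (stairC i j 3 U)).trace * (starRingEnd ℂ) ((ρ (stairM i j 3 3 U)).trace) =
        ((Complex.normSq ((ρ (stairC i j 3 U)).trace) : ℝ) : ℂ) := by
    intro U
    rw [stairM_of_le le_rfl, Complex.mul_conj]
  simp_rw [h3]
  rw [integral_complex_ofReal]
  push_cast
  ring

/-- `P₀ = ∫ |tr ρ(stairC 3 U)|² dπ > 0` (`N ≥ 1`). -/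
theorem integral_normSq_trace_stairC_pos (hρ : Continuous ρ) (hN : 1 ≤ N) :
    0 < ∫ U, Complex.normSq ((ρ (stairC i j 3 U)).trace) ∂(linkMeasure 3 G) := by
  have h := integral_final_pos (L := 3) (i := i) (j := j) ρ hρ hN 0
  have h1 : ∀ U : GaugeConfig 2 3 G, layerW ρ i j 0 U = 1 := fun U => by simp [layerW]
  simpa only [h1, mul_one] using h

/-! ### The moments -/

/-- Expanding `R^k`: the `k`-th moment is the sum of the tuple terms. -/
theorem integral_pair_mul_pow_eq_sum (hρ : Continuous ρ) (k : ℕ) :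
    ∫ U, (ρ (stairC i j 3 U)).trace * (starRingEnd ℂ) ((ρ (stairD i j 3 U)).trace) *
        (((∑ y, rr ρ i j U y : ℝ)) : ℂ) ^ k ∂(linkMeasure 3 G) =
      ∑ p : Fin k → Site 2 3, ∫ U, (ρ (stairC i j 3 U)).trace * (starRingEnd ℂ) ((ρ (stairD i j 3 U)).trace) *
        ∏ m, (rr ρ i j U (p m) : ℂ) ∂(linkMeasure 3 G) := by
  have hexp : ∀ U : GaugeConfig 2 3 G, (((∑ y, rr ρ i j U y : ℝ)) : ℂ) ^ k =
      ∑ p : Fin k → Site 2 3, ∏ m, (rr ρ i j U (p m) : ℂ) := fun U => by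
    rw [Complex.ofReal_sum, Fintype.sum_pow]
  simp_rw [hexp, Finset.mul_sum]
  rw [integral_finsetSum]
  intro p _
  exact (((continuous_stairPair ρ hρ).mul (continuous_finsetProd _ fun m _ =>
    Complex.continuous_ofReal.comp (continuous_rr' ρ hρ _))).integrable_of_hasCompactSupport
      (HasCompactSupport.of_compactSpace _))

/-- ★★ **ORDERS `0, 1, 2` VANISH**: `∫ Φ₀ R^k dπ = 0` for `k < 3`. -/
theorem integral_pair_mul_pow_eq_zero (hij : i ≠ j) (hρ : Continuous ρ)
    (hirr : TwistedSlab.HasScalarCommutant ρ) (hρ1 : ∃ g, ρ g ≠ 1) {k : ℕ} (hk : k < 3) :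
    ∫ U, (ρ (stairC i j 3 U)).trace * (starRingEnd ℂ) ((ρ (stairD i j 3 U)).trace) *
        (((∑ y, rr ρ i j U y : ℝ)) : ℂ) ^ k ∂(linkMeasure 3 G) = 0 := by
  rw [integral_pair_mul_pow_eq_sum ρ hρ k]
  exact Finset.sum_eq_zero fun p _ => integral_term_eq_zero_of_lt ρ hij hρ hirr hρ1 hk p

/-- ★★ **ORDER `3` IS POSITIVE**: `∫ Φ₀ R³ dπ = c` with `c` real and
`c ≥ κ³ ∫ |tr ρ(stairC 3 U)|² dπ > 0` (every triple term is `0` or equal to the mirror term). -/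
theorem integral_pair_mul_cube (hij : i ≠ j) (hρ : Continuous ρ)
    (hirr : TwistedSlab.HasScalarCommutant ρ) (hρ1 : ∃ g, ρ g ≠ 1) :
    ∃ c : ℝ, 0 < c ∧
      ∫ U, (ρ (stairC i j 3 U)).trace * (starRingEnd ℂ) ((ρ (stairD i j 3 U)).trace) *
        (((∑ y, rr ρ i j U y : ℝ)) : ℂ) ^ 3 ∂(linkMeasure 3 G) = (c : ℂ) := by
  have hN := one_le_of_exists_ne_one ρ hρ1
  obtain ⟨κ, hκpos, hκ⟩ := wAvg_reChar_eq_smul_pos ρ hirr hρ hN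
  set J : ℝ := κ ^ 3 * ∫ U, Complex.normSq ((ρ (stairC i j 3 U)).trace) ∂(linkMeasure 3 G) with hJ
  have hJpos : 0 < J := mul_pos (pow_pos hκpos 3) (integral_normSq_trace_stairC_pos ρ hρ hN)
  -- every triple term is `0` or `J`
  have hdich : ∀ p : Fin 3 → Site 2 3,
      (∫ U, (ρ (stairC i j 3 U)).trace * (starRingEnd ℂ) ((ρ (stairD i j 3 U)).trace) *
          ∏ m, (rr ρ i j U (p m) : ℂ) ∂(linkMeasure 3 G)) = 0 ∨
      (∫ U, (ρ (stairC i j 3 U)).trace * (starRingEnd ℂ) ((ρ (stairD i j 3 U)).trace) *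
          ∏ m, (rr ρ i j U (p m) : ℂ) ∂(linkMeasure 3 G)) = (J : ℂ) := by
    intro p
    by_cases hp : ∃ σ : Equiv.Perm (Fin 3), ∀ t, p (σ t) = dg (t : ℕ)
    · obtain ⟨σ, hσ⟩ := hp
      right
      have hprod : ∀ U : GaugeConfig 2 3 G, ∏ m, (rr ρ i j U (p m) : ℂ) =
          ∏ t : Fin 3, (rr ρ i j U (dg (t : ℕ)) : ℂ) :=
        fun U => prod_eq_prod_dg hσ (fun y => (rr ρ i j U y : ℂ))
      simp_rw [hprod]
      exact integral_term_dg_eq ρ hij hρ hκ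
    · exact Or.inl (integral_term_eq_zero_of_not_perm ρ hij hρ hirr hρ1 hp)
  -- the mirror triple itself has term `J`
  have hT0 : (∫ U, (ρ (stairC i j 3 U)).trace * (starRingEnd ℂ) ((ρ (stairD i j 3 U)).trace) *
      ∏ m, (rr ρ i j U ((fun t : Fin 3 => (dg (t : ℕ) : Site 2 3)) m) : ℂ) ∂(linkMeasure 3 G)) = (J : ℂ) :=
    integral_term_dg_eq ρ hij hρ hκ
  have hre : ∀ p : Fin 3 → Site 2 3, 0 ≤ (∫ U, (ρ (stairC i j 3 U)).trace *
      (starRingEnd ℂ) ((ρ (stairD i j 3 U)).trace) * ∏ m, (rr ρ i j U (p m) : ℂ) ∂(linkMeasure 3 G)).re :=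
    fun p => by
    rcases hdich p with h | h
    · rw [h, Complex.zero_re]
    · rw [h, Complex.ofReal_re]; exact hJpos.le
  have him : ∀ p : Fin 3 → Site 2 3, (∫ U, (ρ (stairC i j 3 U)).trace *
      (starRingEnd ℂ) ((ρ (stairD i j 3 U)).trace) * ∏ m, (rr ρ i j U (p m) : ℂ) ∂(linkMeasure 3 G)).im = 0 :=
    fun p => by
    rcases hdich p with h | h
    · rw [h, Complex.zero_im]
    · rw [h, Complex.ofReal_im]
  rw [integral_pair_mul_pow_eq_sum ρ hρ 3]
  refine ⟨(∑ p : Fin 3 → Site 2 3, ∫ U, (ρ (stairC i j 3 U)).trace *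
      (starRingEnd ℂ) ((ρ (stairD i j 3 U)).trace) * ∏ m, (rr ρ i j U (p m) : ℂ) ∂(linkMeasure 3 G)).re,
    ?_, ?_⟩
  · rw [Complex.re_sum]
    refine lt_of_lt_of_le hJpos ?_
    have h := Finset.single_le_sum (f := fun p : Fin 3 → Site 2 3 => (∫ U, (ρ (stairC i j 3 U)).trace *
      (starRingEnd ℂ) ((ρ (stairD i j 3 U)).trace) * ∏ m, (rr ρ i j U (p m) : ℂ) ∂(linkMeasure 3 G)).re)
      (fun p _ => hre p) (Finset.mem_univ (fun t : Fin 3 => (dg (t : ℕ) : Site 2 3)))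
    rwa [hT0, Complex.ofReal_re] at h
  · refine Complex.ext ?_ ?_
    · rw [Complex.ofReal_re]
    · rw [Complex.ofReal_im, Complex.im_sum]
      exact Finset.sum_eq_zero fun p _ => him p

end Terms

end DiagRPTwo

end

end Summit.QuantumFields.GaugeBoot
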